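import Mathlib.RingTheory.Nullstellensatz
import Mathlib.Algebra.MonoidAlgebra.MapDomain
import Mathlib.LinearAlgebra.Basis.VectorSpace
import Literature.RingTheory.ZeroDimensional.RationalShapeLemma
import HarnessLib

/-!
# Coordinates of the points of a finite zero set are algebraic

Topic `Literature/RingTheory/ZeroDimensional`, companion of `RationalShapeLemma.lean`, supplying
the algebraicity hypothesis of the rational shape lemma: if `K ⊇ k` is algebraically closed and
the common zero set in `K^ι` (`ι` finite) of a family of polynomials `F_j ∈ k[X_ι]` is a FINITE set
`V`, then every coordinate of every point of `V` is algebraic (integral) over `k`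
(`isIntegral_coord_of_finite_zeroSet`). Consequently the rational shape lemma holds for finite
zero sets without any further hypothesis (`exists_rational_shape_of_finite_zeroSet`).

## Proof

By Hilbert's Nullstellensatz over `K` (Mathlib, `MvPolynomial.vanishingIdeal_zeroLocus_eq_radical`)
the univariate polynomial `∏_{z ∈ V} (X_i - z_i) ∈ K[X]`, which vanishes on `V`, has a power `q(X_i)`
(`q ∈ K[T]` monic) in the ideal generated by the `F_j` in `K[X]`: `q(X_i) = ∑_t f_t F_{j_t}`.
Choose a `k`-linear retraction `π : K → k` of the inclusion and apply it coefficientwise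
(`AddMonoidAlgebra.map`): since the `F_j` have coefficients in `k`, `Π(f F_j) = Π(f) F_j`
(`map_mul_map_algebraMap`), so `Π(q(X_i)) = ∑_t Π(f_t) F_{j_t}` vanishes at every point of `V`,
while `Π(q(X_i)) = q^π(X_i)` for the polynomial `q^π ∈ k[T]` with coefficients `π(q_m)`, which is
monic because `π(1) = 1`. Hence `q^π(z_i) = 0` for all `z ∈ V`.

## References

* D. Hilbert's Nullstellensatz, in the form of Mathlib's `Mathlib.RingTheory.Nullstellensatz`;
  the statement is standard (e.g. the finiteness theorem for zero-dimensional ideals,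
  Cox–Little–O'Shea, *Ideals, Varieties, and Algorithms*, Ch. 5 §3, Thm. 6). [folklore]
-/

noncomputable section

open Polynomial

namespace Literature.RingTheory.ZeroDimensional

variable {k K : Type*} [Field k] [Field K] [Algebra k K] {ι : Type*}

/-- The coefficientwise image of a polynomial over `K` under an additive map `π : K →+ k`
(`AddMonoidAlgebra.map`); when `π` is `k`-linear and `G` has coefficients in `k`,
`Pr(f · G) = Pr(f) · G`. [folklore] -/
theorem map_mul_map_algebraMap (π : K →ₗ[k] k) (f : MvPolynomial ι K) (G : MvPolynomial ι k) :
    AddMonoidAlgebra.map π.toAddMonoidHom (f * MvPolynomial.map (algebraMap k K) G) =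
      AddMonoidAlgebra.map π.toAddMonoidHom f * G := by
  classical
  apply MvPolynomial.ext
  intro m
  rw [MvPolynomial.coeff_addMonoidAlgebraMap, MvPolynomial.coeff_mul, MvPolynomial.coeff_mul,
    LinearMap.toAddMonoidHom_coe, map_sum]
  refine Finset.sum_congr rfl fun x _ => ?_
  rw [MvPolynomial.coeff_map, MvPolynomial.coeff_addMonoidAlgebraMap, LinearMap.toAddMonoidHom_coe,
    mul_comm (MvPolynomial.coeff x.1 f), ← Algebra.smul_def, LinearMap.map_smul, smul_eq_mul, mul_comm]

/-- `Pr(c • X_i^m) = π(c) • X_i^m`. [folklore] -/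
theorem map_smul_X_pow (π : K →ₗ[k] k) (c : K) (i : ι) (m : ℕ) :
    AddMonoidAlgebra.map π.toAddMonoidHom (c • (MvPolynomial.X i ^ m : MvPolynomial ι K)) =
      π c • (MvPolynomial.X i ^ m : MvPolynomial ι k) := by
  classical
  apply MvPolynomial.ext
  intro d
  rw [MvPolynomial.coeff_addMonoidAlgebraMap, MvPolynomial.coeff_smul, MvPolynomial.coeff_smul,
    MvPolynomial.coeff_X_pow, MvPolynomial.coeff_X_pow, LinearMap.toAddMonoidHom_coe]
  split_ifs <;> simp

/-- **The coordinates of the points of a finite zero set are algebraic.** If `K ⊇ k` is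
algebraically closed and the common zero set in `K^ι` (`ι` finite) of a family of polynomials over
`k` is a finite set `V`, then every coordinate of every point of `V` is integral over `k`.
Proof: by the Nullstellensatz over `K`, a power of `∏_{z ∈ V} (X_i - z_i)` lies in the ideal
generated by the `F_j` in `K[X]`; applying a `k`-linear retraction `K → k` coefficientwise gives a
MONIC polynomial in `X_i` over `k` which is a `k[X]`-combination of the `F_j`, hence vanishes at
the points of `V`. [folklore] -/
theorem isIntegral_coord_of_finite_zeroSet [IsAlgClosed K] [Finite ι] {σ : Type*}
    (F : σ → MvPolynomial ι k) (V : Finset (ι → K))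
    (hV : ∀ z : ι → K, z ∈ V ↔ ∀ j, MvPolynomial.aeval z (F j) = 0) :
    ∀ z ∈ V, ∀ i, IsIntegral k (z i) := by
  classical
  intro z₀ hz₀ i
  -- a `k`-linear retraction of `k ⊆ K`
  obtain ⟨π, hπ⟩ := (Algebra.linearMap k K).exists_leftInverse_of_injective
    (LinearMap.ker_eq_bot.2 (algebraMap k K).injective)
  have hπ1 : ∀ a : k, π (algebraMap k K a) = a := fun a => LinearMap.congr_fun hπ a
  -- the ideal over `K` and its zero locus
  set G : σ → MvPolynomial ι K := fun j => MvPolynomial.map (algebraMap k K) (F j) with hG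
  set I : Ideal (MvPolynomial ι K) := Ideal.span (Set.range G) with hI
  have hVZ : (V : Set (ι → K)) = MvPolynomial.zeroLocus K I := by
    ext w
    rw [hI, MvPolynomial.zeroLocus_span, Finset.mem_coe, hV]
    simp only [Set.mem_setOf_eq, Set.forall_mem_range, hG, MvPolynomial.aeval_map_algebraMap]
  -- the univariate polynomial `∏ (X_i - z_i)` vanishes on `V`
  set p : K[X] := ∏ z ∈ V, (X - C (z i)) with hp
  have hpmonic : p.Monic := monic_prod_of_monic _ _ fun _ _ => monic_X_sub_C _
  have hpV : Polynomial.aeval (MvPolynomial.X i : MvPolynomial ι K) p ∈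
      MvPolynomial.vanishingIdeal K (V : Set (ι → K)) := by
    rw [MvPolynomial.mem_vanishingIdeal_iff]
    intro w hw
    rw [← Polynomial.aeval_algHom_apply, MvPolynomial.aeval_X, hp, map_prod]
    exact Finset.prod_eq_zero (Finset.mem_coe.1 hw) (by simp)
  rw [hVZ, MvPolynomial.vanishingIdeal_zeroLocus_eq_radical] at hpV
  obtain ⟨e, he⟩ := hpV
  rw [← map_pow] at he
  set q : K[X] := p ^ e with hq
  have hqmonic : q.Monic := hpmonic.pow e
  -- a finite combination of the generators
  obtain ⟨nn, f, g, hsum⟩ := Submodule.mem_span_set'.1 he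
  have hg : ∀ t, ∃ j, (g t : MvPolynomial ι K) = G j := fun t => by
    obtain ⟨j, hj⟩ := (g t).2; exact ⟨j, hj.symm⟩
  choose js hjs using hg
  -- apply the retraction coefficientwise
  set Pr : MvPolynomial ι K → MvPolynomial ι k := AddMonoidAlgebra.map π.toAddMonoidHom with hPr
  have hPrsum : Pr (Polynomial.aeval (MvPolynomial.X i : MvPolynomial ι K) q) =
      ∑ t, Pr (f t) * F (js t) := by
    rw [← hsum, hPr, AddMonoidAlgebra.map_sum]
    refine Finset.sum_congr rfl fun t _ => ?_
    rw [smul_eq_mul, hjs t, hG]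
    exact map_mul_map_algebraMap π (f t) (F (js t))
  -- the monic polynomial over `k`
  set qk : k[X] := ∑ m ∈ Finset.range (q.natDegree + 1), C (π (q.coeff m)) * X ^ m with hqk
  have hPrq : Pr (Polynomial.aeval (MvPolynomial.X i : MvPolynomial ι K) q) =
      ∑ m ∈ Finset.range (q.natDegree + 1), π (q.coeff m) • (MvPolynomial.X i : MvPolynomial ι k) ^ m := by
    rw [Polynomial.aeval_eq_sum_range, hPr, AddMonoidAlgebra.map_sum]
    exact Finset.sum_congr rfl fun m _ => map_smul_X_pow π _ i m
  have hroot : Polynomial.aeval (z₀ i) qk = 0 := by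
    have h1 : MvPolynomial.aeval z₀ (Pr (Polynomial.aeval (MvPolynomial.X i : MvPolynomial ι K) q)) = 0 := by
      rw [hPrsum, map_sum]
      refine Finset.sum_eq_zero fun t _ => ?_
      rw [map_mul, (hV z₀).1 hz₀ (js t), mul_zero]
    rw [hPrq, map_sum] at h1
    rw [hqk, map_sum, ← h1]
    refine Finset.sum_congr rfl fun m _ => ?_
    rw [map_mul, Polynomial.aeval_C, map_pow, Polynomial.aeval_X, map_smul, map_pow,
      MvPolynomial.aeval_X, Algebra.smul_def]
  have hqkmonic : qk.Monic := by
    have htop : π (q.coeff q.natDegree) = 1 := by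
      rw [Polynomial.coeff_natDegree, hqmonic.leadingCoeff, ← (algebraMap k K).map_one, hπ1]
    rw [hqk, Finset.sum_range_succ, htop, map_one, one_mul, add_comm]
    refine (monic_X_pow _).add_of_left ?_
    rw [degree_X_pow]
    refine (degree_sum_le _ _).trans_lt ((Finset.sup_lt_iff (WithBot.bot_lt_coe _)).2 ?_)
    intro m hm
    exact (degree_C_mul_X_pow_le m _).trans_lt (by exact_mod_cast Finset.mem_range.1 hm)
  exact ⟨qk, hqkmonic, by rwa [← Polynomial.aeval_def]⟩


/-- **The rational shape lemma for a finite zero set** (no algebraicity hypothesis): for fields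
`k ⊆ K`, `k` perfect, `K` algebraically closed, a finite common zero set `V ⊆ K^ι` of polynomials
over `k` and a separating linear form `ℓ` with coefficients in `k`, there are a monic `μ ∈ k[T]` of
degree `|V|` with `μ = ∏_{z ∈ V}(T - ℓ(z))` over `K` and polynomials `v_i ∈ k[T]` of degree `< |V|`
with `z_i = v_i(ℓ(z))` on `V` (Krick–Pardo 1996, Prop. 27 (1)–(2) as used by Bürgisser 2000 TCS,
p. 82; `exists_rational_shape` with `isIntegral_coord_of_finite_zeroSet`).
[cite: Burgisser2000TCS, proof of Thm. 4.5 p. 82] -/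
theorem exists_rational_shape_of_finite_zeroSet [PerfectField k] [IsAlgClosed K] [Fintype ι]
    [DecidableEq ι] {σ : Type*} (F : σ → MvPolynomial ι k) (V : Finset (ι → K))
    (hV : ∀ z : ι → K, z ∈ V ↔ ∀ j, MvPolynomial.aeval z (F j) = 0) (ℓ : ι → k)
    (hsep : Set.InjOn (fun z : ι → K => ∑ i, algebraMap k K (ℓ i) * z i) (V : Set (ι → K))) :
    ∃ μ : k[X], μ.Monic ∧ μ.natDegree = V.card ∧
      (∀ z ∈ V, aeval (∑ i, algebraMap k K (ℓ i) * z i) μ = 0) ∧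
      μ.map (algebraMap k K) = ∏ z ∈ V, (X - C (∑ i, algebraMap k K (ℓ i) * z i)) ∧
      ∀ i, ∃ v : k[X], v.degree < (V.card : WithBot ℕ) ∧
        ∀ z ∈ V, z i = aeval (∑ i', algebraMap k K (ℓ i') * z i') v :=
  exists_rational_shape F V hV (isIntegral_coord_of_finite_zeroSet F V hV) ℓ hsep

end Literature.RingTheory.ZeroDimensional

end
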